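import Summits.BirchSwinnertonDyer.BirchSwinnertonDyer.Theorems.QuadraticBranchSignedControlPlusEtaLowerInclusionValuationSqueezeHeightPart
import Summits.BirchSwinnertonDyer.BirchSwinnertonDyer.Theorems.QuadraticBranchSignedControlPlusEtaR1TamagawaRowShape
import Summits.BirchSwinnertonDyer.BirchSwinnertonDyer.Theorems.Rank1ResidualX11RankOneMinimality
import Summits.BirchSwinnertonDyer.Rank1Residual.Additive.IntModelTamagawaCertificate
import HarnessLib

/-!
# Route `QuadraticBranchSignedControl` (rung K8, cell `bsd-potss`), crux `PlusEtaLowerInclusion`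
# (item stmt-BirchSwinnertonDyer-19601): the RANK-ONE HEIGHT ROW `69150v1` — (E⁺_η) ∧ (C1⁺_η) at `p = 5`
# for every tower-onto good supersingular twist of `W = 69150v1` MODULO ONE DISPLAYED UNIT OF HEIGHT INDEX,
# its Tamagawa part CERTIFIED IN THE KERNEL (seat `bsd-potss-k8eta-c1` g10; `--supports` 19601)

WHAT. `69150v1` is the LAST of the 40 tower-onto census rows of crux 19601 without an instrument record
(g3–g9: `r_an = 1`, `p = 5`, Tamagawa-`5` primes `c₂ = 5`, `c₃ = 10`, `v_an = 2`; the Tamagawa road gives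
`v_alg ≥ 1` only — generator OFF the identity component at `2` and `3`, g5 — and the Kurihara road is void,
Kim Remark 6.2). By g10's splitting `#coker φ_X = #(X_η/TX_η)_tors · #heightIndex`
(`…ValuationSqueezeHeightPart`) the row needs torsion exponent `a = 1` (Tamagawa, Poitou–Tate — this file,
in the kernel modulo the named facts) AND height-index exponent `b = 1` (DISPLAYED, OPEN). §1 fills the
torsion slot of g10's road by the Tamagawa road (p515151 §1): (E⁺_η) ∧ (C1⁺_η) at a pair from
`a + r ≤ ∑_T ord_p c_ℓ(W)`, `p^b ∣` height index and the analytic certificate at `a + b`; §2 the record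
shape from a kernel ROW CERTIFICATE with two Tamagawa-`p` primes `p ∥ c_ℓ` (`a = 1`, `r ≤ 1`) and a
displayed height-index exponent `b`; §3 the row `69150v1` (`b = 1`, analytic certificate `5³ ∤ coeff₁ L_5⁺(V,η,T)`).
EVIDENCE for the displayed binder (NOT a kernel fact): g10's η-PLUS p-ADIC HEIGHT INSTRUMENT (kit j302973,
HOME/k8eta-c1/g10/): the η-plus Bernardi–Perrin-Riou height of the generator `P = (12, 669)` of `W(ℚ)` at the
additive prime `5` has valuation `ρ = 1`, one above each of the 13 two-Tamagawa-prime sibling rows (`ρ = 0`),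
and the predicted direction of the η-branch D-valued leading term matches PARI's to 3 digits on 11/11 rows;
under the η-analogue of Castella's leading-term formula (arXiv:2502.19618 Thm. 1; NOT in print at `η`) this
is exactly `b = 1`.

HONEST LABEL (cell `bsd-potss`, HUMAN RULING D-0036/D-0074/D-0088(2)): the row theorem is CONDITIONAL on
NAMED facts in hypothesis position (Kobayashi 2003 Thm. 1.2/1.3/2.2η/4.1η, Kitajima–Otsuki 2018 Thm. 1.3 at
`η`, Poitou–Tate = Milne I.4.10) and on DISPLAYED per-pair inputs: `rank W(ℚ) ≤ 1` (GZK; NOT proved here),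
on the twist `V`: `ρ_{V,5^m}` onto for all `m`, the `V`-certificate, the ANALYTIC certificate
`125 ∤ coeff₁ L_5⁺(V,η,T)` (g3's kit census `v_an = 2`; EVIDENCE tier), and the HEIGHT-INDEX binder
`5 ∣ #(D.X/T·D.X ⁄ (tors ⊔ φ(D.X[T])))` for every η-datum `D` (OPEN; instrument-consistent only). IN THE
KERNEL: `Δ ≠ 0`, global minimality, the complete local Tamagawa data of `W`. A PER-ROW INSTANCE; the
class-wide crux 19601 is OPEN and NOT closed; the census tally 39/40 is NOT changed by this file; nothing is
booked; `BSD(W,5)` is not claimed. No `sorry`, no definition, axioms standard.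

References: [Kobayashi2003] §4 Even MC + Thm. 4.1 (p. 8), Thm. 2.2 (p. 5), Thm. 9.3; [KitajimaOtsuki2018]
Thm. 1.3; [MilneADT2006] I Thm. 4.10; [CoatesSchneiderSujatha2003] §3 (30)–(31); [SilvermanATAEC1994] IV.9.4;
[Cremona1997] Table 1; [Kraus1989]; [Castella2025] arXiv:2502.19618 Thm. 1 (trivial branch).
-/

set_option autoImplicit false
set_option linter.dupNamespace false

noncomputable section

open scoped Classical

open CongruenceSubgroup Field WeierstrassCurve NumberField IsDedekindDomain
open Literature.NumberTheory.EllipticCurves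
open Literature.NumberTheory.EllipticCurves.ModularForms
open Literature.NumberTheory.GaloisRepresentations
open Literature.NumberTheory.GaloisCohomology
open Summit.BirchSwinnertonDyer.Rank1Residual.Additive
open Summit.BirchSwinnertonDyer.BirchSwinnertonDyer.Rank2Observatory.Tam
open Summit.BirchSwinnertonDyer.BirchSwinnertonDyer.Rank1Residual.X11RankOne

namespace Summit.BirchSwinnertonDyer.BirchSwinnertonDyer.Theorems

/-! ## §1 The torsion slot filled by the Tamagawa road: (E⁺_η) ∧ (C1⁺_η) from `a + r ≤ ∑ ord_p c_ℓ(W)` and the height index -/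

section Tamagawa

variable {V : WeierstrassCurve ℚ} [V.IsElliptic] [V.IsGloballyMinimal] {p : ℕ} [hp : Fact p.Prime]

/-- **THE TAMAGAWA ROAD WITH A HEIGHT INDEX: (E⁺_η) ∧ (C1⁺_η) at a tower-onto pair of any rank.**
GRANTED Kobayashi's Thm. 1.2 / 1.3 / 2.2(η) / 4.1(η), Kitajima–Otsuki's Thm. 1.3 at `η` and Poitou–Tate
duality (NAMED facts), on a good `a_p = 0` pair with `p ≥ 5`, `ρ_{V,p^m}` onto, the `V`-certificate, the
`p*`-partner `W` with a finite `T ∌ (p)` containing every `ℓ ≠ p` with `p ∣ c_ℓ(W)` and `ord_p c_ℓ(W) ≤ 1` on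
`T`, TWO integers `a`, `b` with the ARITHMETIC input `a + r ≤ ∑_{ℓ ∈ T} ord_p c_ℓ(W)`
(`r = rank V^{(p*)}(ℚ)`; p515151 §1 then gives `p^a ∣ #(X_η/TX_η)_tors`), the HEIGHT-INDEX input
`p^b ∣ #(D.X/T·D.X ⁄ (tors ⊔ φ(D.X[T])))` for every `η`-datum `D`, and the ANALYTIC certificate
`p^{a+b+1} ∤ coeff_r L_p⁺(V,η,T)`: (E⁺_η)(V, p) ∧ (C1⁺_η)(V, p). `b = 0` is p515151 §3. On crux 19601's
residue row `69150v1` (`c₂ = 5`, `c₃ = 10`, `r = 1`, `v_an = 2`): `a = 1`, `b = 1` — the height index is the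
row's one OPEN input. CONDITIONAL; closes nothing class-wide; certifies no row in the kernel.
[cite: Kobayashi2003, Thm. 2.2 (p. 5), §4 Even main conjecture and Thm. 4.1 (p. 8), Thm. 9.3 (pp. 26–27)]
[cite: KitajimaOtsuki2018, Thm. 1.3] [cite: MilneADT2006, Ch. I, Thm. 4.10] [cite: CoatesSchneiderSujatha2003, §3 (30)–(31)] -/
theorem quadraticBranchPlusEta_pair_of_namedFacts_of_poitouTate_of_tamagawa_of_heightIndexDvd
    (h12 : Kobayashi2003.thm12_signedSelmerDual_finite_torsion)
    (h13 : Kobayashi2003.thm41_signedCharIdeal_divisibility)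
    (h22 : Kobayashi2003.thm22_etaSignedSelmerDual_finite_torsion)
    (h41 : Kobayashi2003.thm41_plusEtaCharIdeal_dvd)
    (hKO : KitajimaOtsuki2018.mainThm13_etaSignedSelmerDual_noFiniteSubmodule)
    (hPT : poitouTate_selmerStructure_duality_real ℚ)
    (hp5 : 5 ≤ p) (hgood : V.HasGoodReductionAtPrime p) (hap : V.frobeniusTrace p = 0)
    (hsurj : ∀ m : ℕ, V.HasSurjectiveModNGaloisRep (p ^ m : ℕ))
    (hcertV : ∀ {N : ℕ} [NeZero N] (f : CuspForm (Gamma0 N) 2), IsNewformOf V f →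
      ∃ L : IwasawaAlgebra p, Kobayashi2003.IsSignedPAdicLFunction f p 1 L ∧
        IsUnit (PowerSeries.coeff V.mordellWeilRank L))
    (W : WeierstrassCurve ℚ) [W.IsElliptic] [W.IsGloballyMinimal] (C : VariableChange ℚ)
    (hCV : C • W.quadraticTwist ((-1) ^ (p / 2) * p) = V)
    (T : Finset (HeightOneSpectrum (𝓞 ℚ)))
    (hpT : (Rat.HeightOneSpectrum.primesEquiv (R := 𝓞 ℚ)).symm ⟨p, hp.out⟩ ∉ T)
    (hT : ∀ v : HeightOneSpectrum (𝓞 ℚ), v ≠ (Rat.HeightOneSpectrum.primesEquiv (R := 𝓞 ℚ)).symm ⟨p, hp.out⟩ →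
      p ∣ (W.baseChange (v.adicCompletion ℚ)).localTamagawaNumber (v.adicCompletionIntegers ℚ) → v ∈ T)
    (hT1 : ∀ w ∈ T, padicValNat p ((W.baseChange (w.adicCompletion ℚ)).localTamagawaNumber
      (w.adicCompletionIntegers ℚ)) ≤ 1)
    (a b : ℕ)
    (ha : a + (V.quadraticTwist ((-1) ^ (p / 2) * p)).mordellWeilRank ≤
      ∑ w ∈ T, padicValNat p ((W.baseChange (w.adicCompletion ℚ)).localTamagawaNumber
        (w.adicCompletionIntegers ℚ)))
    (hht : ∀ (K₀ : Type) [Field K₀] [NumberField K₀] [IsCyclotomicExtension {p} ℚ K₀]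
      [(galRange (K := ℚ) K₀).Normal] (ηq : absoluteGaloisGroup ℚ →* ℤˣ),
      (∀ σ ∈ galRange (K := ℚ) K₀, ηq σ = 1) → ηq ≠ 1 →
      ∀ (κ : ZpExtension ℚ p) (γ : absoluteGaloisGroup ℚ),
        κ.IsCyclotomic → κ.IsTopGenerator γ → γ ∈ galRange (K := ℚ) K₀ → IsCyclotomicVariable p γ →
      ∀ (D : EtaSignedSelmerDualData V κ K₀ ℚ_[p] ηq γ 1),
        p ^ b ∣ Nat.card (IwasawaAlgebra.coinvariants p D.X ⧸
          (Submodule.torsion ℤ (IwasawaAlgebra.coinvariants p D.X) ⊔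
            (LinearMap.range (IwasawaAlgebra.bockstein p D.X)).restrictScalars ℤ)))
    (han : ∀ {N : ℕ} [NeZero N] {f : CuspForm (Gamma0 N) 2}, IsNewformOf V f →
      ∀ (ϖ : ℚ), (if Even (p / 2) then (ϖ : ℝ) * V.realPeriodRat = plusPeriod f
          else (ϖ : ℝ) * V.imaginaryPeriodRat = minusPeriod f) →
      ∀ (Lη : IwasawaAlgebra p), IsQuadraticBranchPlusLFunction f p ϖ Lη →
        ¬ (p : ℤ_[p]) ^ (a + b + 1) ∣
          PowerSeries.coeff (V.quadraticTwist ((-1) ^ (p / 2) * p)).mordellWeilRank Lη) :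
    QuadraticBranchPlusEtaLowerInclusionAt V p ∧ QuadraticBranchPlusEtaMainConjectureAt V p := by
  have hE : QuadraticBranchPlusEtaLowerInclusionAt V p :=
    quadraticBranchPlusEtaLowerInclusionAt_of_namedFacts_of_certV_of_torsionDvd_of_heightIndexDvd h12 h13
      h22 h41 hKO hp5 hgood hap hsurj (fun f hf => hcertV f hf) a b (fun hf => han hf)
      (fun K₀ _ _ _ _ ηq hηK hη1 κ γ hκ hγ hγK hγc _ _ _ hf ϖ hϖ Lη hL hne D =>
        pow_dvd_natCard_torsion_coinvariants_of_namedFacts_of_poitouTate_of_tamagawa h12 h13 h22 h41 hPT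
          hp5 hgood hap hsurj (fun f hf => hcertV f hf) hf ϖ hϖ Lη hL hne W C hCV T hpT hT hT1 K₀ ηq hηK
          hη1 κ γ hκ hγ hγK hγc D a ha)
      hht
  exact ⟨hE, quadraticBranchPlusEtaMainConjectureAt_of_facts_of_surjective_of_etaLowerInclusion h22 h41
    hsurj hE⟩

end Tamagawa

/-! ## §2 The record shape: two Tamagawa-`p` primes + a displayed height-index exponent -/

section Shape

variable {p : ℕ} [hp : Fact p.Prime]

/-- **RECORD SHAPE — (E⁺_η) ∧ (C1⁺_η) on a Tamagawa row with a HEIGHT-INDEX exponent.** GRANTED the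
named facts (Kobayashi 1.2/1.3/2.2η/4.1η, Kitajima–Otsuki 1.3η, Poitou–Tate), `p ≥ 5`, an integer equation
`W₀` with a PASSING ROW CERTIFICATE `Es` and a list `L` of TWO listed primes `≠ p` carrying the exact
certified values `c` with `p ∥ c`, every other listed prime `≠ p` having certified values prime to `p`,
`W = W₀ ⊗ ℚ` globally minimal with `rank W(ℚ) ≤ 1` (DISPLAYED), an exponent `b`: for every globally minimal
`V` with `C • W^{(p*)} = V`, good at `p`, `a_p(V) = 0`, `ρ_{V,p^m}` onto, the `V`-certificate, the
HEIGHT-INDEX input `p^b ∣ #(D.X/T·D.X ⁄ (tors ⊔ φ(D.X[T])))` for every η-datum `D` and the ANALYTIC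
certificate `p^{b+2} ∤ coeff_r L_p⁺(V,η,T)`: **(E⁺_η)(V,p) ∧ (C1⁺_η)(V,p)** (§1 with `T = pl(L)`, `a = 1`,
`r ≤ 1 ≤ 2 − 1`). `b = 0` is p517313's shape. CONDITIONAL; closes nothing class-wide.
[cite: Kobayashi2003, Thm. 2.2 (p. 5), §4 Even main conjecture and Thm. 4.1 (p. 8)]
[cite: KitajimaOtsuki2018, Thm. 1.3] [cite: MilneADT2006, Ch. I, Thm. 4.10] [cite: SilvermanATAEC1994, IV.9.4] -/
theorem etaPair_of_rowCheck_of_tamagawaPair_of_heightIndexDvd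
    (h12 : Kobayashi2003.thm12_signedSelmerDual_finite_torsion)
    (h13 : Kobayashi2003.thm41_signedCharIdeal_divisibility)
    (h22 : Kobayashi2003.thm22_etaSignedSelmerDual_finite_torsion)
    (h41 : Kobayashi2003.thm41_plusEtaCharIdeal_dvd)
    (hKO : KitajimaOtsuki2018.mainThm13_etaSignedSelmerDual_noFiniteSubmodule)
    (hPT : poitouTate_selmerStructure_duality_real ℚ) (hp5 : 5 ≤ p)
    {Es : List TamLocal} {W₀ : WeierstrassCurve ℤ} (hrow : TamLocal.rowCheck Es W₀ = true)
    (L : List ℕ) (hout : ∀ E ∈ Es, E.p ∉ L → E.p = p ∨ ∀ c ∈ E.vals, ¬ p ∣ c)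
    (hin : ∀ E ∈ Es, E.p ∈ L → E.vals = [E.c] ∧ p ∣ E.c ∧ ¬ p ^ 2 ∣ E.c)
    (hL : ∀ ℓ ∈ L, ℓ ∈ Es.map (·.p)) (hnd : L.Nodup) (hpL : p ∉ L) (hlen : L.length = 2)
    [(W₀.baseChange ℚ).IsElliptic] [hGM : (W₀.baseChange ℚ).IsGloballyMinimal]
    (hrW : (W₀.baseChange ℚ).mordellWeilRank ≤ 1)
    (V : WeierstrassCurve ℚ) [V.IsElliptic] [V.IsGloballyMinimal] (C : VariableChange ℚ)
    (hCV : C • (W₀.baseChange ℚ).quadraticTwist ((-1) ^ (p / 2) * p) = V)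
    (hgood : V.HasGoodReductionAtPrime p) (hap : V.frobeniusTrace p = 0)
    (hsurj : ∀ m : ℕ, V.HasSurjectiveModNGaloisRep (p ^ m : ℕ))
    (hcertV : ∀ {N : ℕ} [NeZero N] (f : CuspForm (Gamma0 N) 2), IsNewformOf V f →
      ∃ L : IwasawaAlgebra p, Kobayashi2003.IsSignedPAdicLFunction f p 1 L ∧
        IsUnit (PowerSeries.coeff V.mordellWeilRank L))
    (b : ℕ)
    (hht : ∀ (K₀ : Type) [Field K₀] [NumberField K₀] [IsCyclotomicExtension {p} ℚ K₀]
      [(galRange (K := ℚ) K₀).Normal] (ηq : Field.absoluteGaloisGroup ℚ →* ℤˣ),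
      (∀ σ ∈ galRange (K := ℚ) K₀, ηq σ = 1) → ηq ≠ 1 →
      ∀ (κ : ZpExtension ℚ p) (γ : Field.absoluteGaloisGroup ℚ),
        κ.IsCyclotomic → κ.IsTopGenerator γ → γ ∈ galRange (K := ℚ) K₀ → IsCyclotomicVariable p γ →
      ∀ (D : EtaSignedSelmerDualData V κ K₀ ℚ_[p] ηq γ 1),
        p ^ b ∣ Nat.card (IwasawaAlgebra.coinvariants p D.X ⧸
          (Submodule.torsion ℤ (IwasawaAlgebra.coinvariants p D.X) ⊔
            (LinearMap.range (IwasawaAlgebra.bockstein p D.X)).restrictScalars ℤ)))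
    (han : ∀ {N : ℕ} [NeZero N] {f : CuspForm (Gamma0 N) 2}, IsNewformOf V f →
      ∀ (ϖ : ℚ), (if Even (p / 2) then (ϖ : ℝ) * V.realPeriodRat = plusPeriod f
          else (ϖ : ℝ) * V.imaginaryPeriodRat = minusPeriod f) →
      ∀ (Lη : IwasawaAlgebra p), IsQuadraticBranchPlusLFunction f p ϖ Lη →
        ¬ (p : ℤ_[p]) ^ (b + 2) ∣
          PowerSeries.coeff (V.quadraticTwist ((-1) ^ (p / 2) * p)).mordellWeilRank Lη) :
    QuadraticBranchPlusEtaLowerInclusionAt V p ∧ QuadraticBranchPlusEtaMainConjectureAt V p := by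
  obtain ⟨hpT, hT, hT1, hsum⟩ := TamagawaRoad.tamagawa_inputs_of_rowCheck hrow hGM p L hout hin hL hnd hpL
  have hd : ((-1 : ℚ) ^ (p / 2) * p) ≠ 0 :=
    mul_ne_zero (pow_ne_zero _ (by norm_num)) (Nat.cast_ne_zero.mpr hp.out.ne_zero)
  have hr : (V.quadraticTwist ((-1) ^ (p / 2) * p)).mordellWeilRank ≤ 1 := by
    rw [TamagawaRoad.mordellWeilRank_quadraticTwist_eq_of_smul_quadraticTwist_eq hd hCV]
    exact hrW
  rw [TamagawaRoad.pl_eq_primesEquiv_symm p] at hpT hT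
  have hab : 1 + b + 1 = b + 2 := by ring
  exact quadraticBranchPlusEta_pair_of_namedFacts_of_poitouTate_of_tamagawa_of_heightIndexDvd
    h12 h13 h22 h41 hKO hPT hp5 hgood hap hsurj (fun f hf => hcertV f hf) (W₀.baseChange ℚ) C hCV
    ((L.map pl).toFinset) hpT hT hT1 1 b (by rw [hsum, hlen]; omega) hht (fun hf => by rw [hab]; exact han hf)

end Shape

/-! ## §3 The row `W = 69150v1` -/

namespace PlusEtaR1HeightRows

/-- The kernel ROW CERTIFICATE of `W = 69150v1` (`[1, 0, 0, -13263, 613017]`): `2`: In `n = 5`, kind 1 (split, root witness), `c = 5`; `3`: In `n = 10`, kind 1 (split, root witness), `c = 10`; `5`: I0* `n = 6`, kind 5 (deep Tate cert), `c = 2` (certified set [1, 2, 4]); `461`: In `n = 1`, kind 3 (non-split, Euler witness), `c = 1`; complete (`|Δ| = ∏ ℓⁿ`).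
Engine `tam.py` (rank-2 observatory) unmodified (seat g5's run, HOME/k8eta-c1/mordellweil-road-g5/tam/cert_69150v1.json); checked by `decide +kernel`. [cite: SilvermanATAEC1994, IV.9.4] [cite: Cremona1997, Table 1 (label 69150v1)] -/
theorem rowCheck_v69150v1 : TamLocal.rowCheck [⟨2, 1, 1, 0, 0, 0, 0, 5, 0, 0, 5⟩, ⟨3, 1, 1, 0, 0, 0, 0, 10, 0, 0, 10⟩, ⟨5, 2, 5, 0, 2, 2, 24, 6, 6, 0, 2⟩, ⟨461, 21, 3, 0, 0, 0, 0, 1, 0, 0, 1⟩] ⟨1, 0, 0, (-13263), 613017⟩ = true := by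
  decide +kernel

set_option maxRecDepth 100000 in
/-- `W = 69150v1` (`[1, 0, 0, -13263, 613017]`) is a GLOBAL MINIMAL equation (bounded Kraus criterion on the literal
coefficients). [cite: Kraus1989] [cite: SilvermanAEC2009, VII.1 Remark 1.1] -/
theorem isGloballyMinimal_v69150v1 : (⟨1, 0, 0, (-13263), 613017⟩ : WeierstrassCurve ℚ).IsGloballyMinimal :=
  isGloballyMinimal_of_krausCriterion_bounded 1 0 0 (-13263) 613017
    (by decide +kernel) (by decide +kernel) (by decide +kernel)

/-- **(E⁺_η) ∧ (C1⁺_η) at `p = 5` for EVERY tower-onto good supersingular twist of `W = 69150v1` MODULO ONE UNIT OF HEIGHT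
INDEX** (Cremona's minimal model `[1, 0, 0, -13263, 613017]`, additive `I₀*` at `5`; its minimal `5`-twist `V` has conductor `2766`,
good supersingular with `a_5(V) = 0`, `ρ_{V,5^∞}` onto, `r_an = 1` — the RESIDUE row of crux 19601's census; Tamagawa-`5`
primes `2:5, 3:10`, `v_an = 2` in g3's table). IN THE KERNEL: `Δ ≠ 0`, global minimality, the local Tamagawa numbers of `W`
at every bad prime (`rowCheck_v69150v1`), hence `∑_T ord₅ c_ℓ(W) = 2` on `T = {2, 3}` (torsion exponent `a = 1`).
DISPLAYED: `rank W(ℚ) ≤ 1`; on `V`: tower onto, the `V`-certificate, the analytic certificate `125 ∤ coeff₁ L_5⁺(V,η,T)`,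
and the HEIGHT-INDEX binder `5 ∣ #(D.X/T·D.X ⁄ (tors ⊔ φ(D.X[T])))` for every η-datum `D` (`b = 1`; OPEN — g10's η-height
instrument reads the generator `(12, 669)` with η-plus height valuation `ρ = 1`, kit j302973, consistent with `b = 1` under the
η-analogue of Castella's formula, which is NOT in print). CONDITIONAL on the named facts; a per-row instance; nothing booked;
`BSD(W,5)` not claimed; census tally unchanged. [cite: Kobayashi2003, §4 Even main conjecture and Thm. 4.1 (p. 8)]
[cite: KitajimaOtsuki2018, Thm. 1.3] [cite: MilneADT2006, Ch. I, Thm. 4.10] [cite: Cremona1997, Table 1 (label 69150v1)] -/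
theorem etaPair_r1_v69150v1_5_of_heightIndexDvd
    (h12 : Kobayashi2003.thm12_signedSelmerDual_finite_torsion)
    (h13 : Kobayashi2003.thm41_signedCharIdeal_divisibility)
    (h22 : Kobayashi2003.thm22_etaSignedSelmerDual_finite_torsion)
    (h41 : Kobayashi2003.thm41_plusEtaCharIdeal_dvd)
    (hKO : KitajimaOtsuki2018.mainThm13_etaSignedSelmerDual_noFiniteSubmodule)
    (hPT : poitouTate_selmerStructure_duality_real ℚ)
    (W : WeierstrassCurve ℚ) (hW : W = ⟨1, 0, 0, (-13263), 613017⟩)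
    (hrW : W.mordellWeilRank ≤ 1)
    (V : WeierstrassCurve ℚ) [V.IsElliptic] [V.IsGloballyMinimal] [Fact (5 : ℕ).Prime]
    (C : VariableChange ℚ) (hCV : C • W.quadraticTwist 5 = V)
    (hgood : V.HasGoodReductionAtPrime 5) (hap : V.frobeniusTrace 5 = 0)
    (hsurj : ∀ m : ℕ, V.HasSurjectiveModNGaloisRep (5 ^ m : ℕ))
    (hcertV : ∀ {N : ℕ} [NeZero N] (f : CuspForm (Gamma0 N) 2), IsNewformOf V f →
      ∃ L : IwasawaAlgebra 5, Kobayashi2003.IsSignedPAdicLFunction f 5 1 L ∧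
        IsUnit (PowerSeries.coeff V.mordellWeilRank L))
    (hht : ∀ (K₀ : Type) [Field K₀] [NumberField K₀] [IsCyclotomicExtension {5} ℚ K₀]
      [(galRange (K := ℚ) K₀).Normal] (ηq : Field.absoluteGaloisGroup ℚ →* ℤˣ),
      (∀ σ ∈ galRange (K := ℚ) K₀, ηq σ = 1) → ηq ≠ 1 →
      ∀ (κ : ZpExtension ℚ 5) (γ : Field.absoluteGaloisGroup ℚ),
        κ.IsCyclotomic → κ.IsTopGenerator γ → γ ∈ galRange (K := ℚ) K₀ → IsCyclotomicVariable 5 γ →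
      ∀ (D : EtaSignedSelmerDualData V κ K₀ ℚ_[5] ηq γ 1),
        5 ∣ Nat.card (IwasawaAlgebra.coinvariants 5 D.X ⧸
          (Submodule.torsion ℤ (IwasawaAlgebra.coinvariants 5 D.X) ⊔
            (LinearMap.range (IwasawaAlgebra.bockstein 5 D.X)).restrictScalars ℤ)))
    (han : ∀ {N : ℕ} [NeZero N] {f : CuspForm (Gamma0 N) 2}, IsNewformOf V f →
      ∀ (ϖ : ℚ), (if Even (5 / 2) then (ϖ : ℝ) * V.realPeriodRat = plusPeriod f
          else (ϖ : ℝ) * V.imaginaryPeriodRat = minusPeriod f) →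
      ∀ (Lη : IwasawaAlgebra 5), IsQuadraticBranchPlusLFunction f 5 ϖ Lη →
        ¬ (5 : ℤ_[5]) ^ 3 ∣ PowerSeries.coeff (V.quadraticTwist 5).mordellWeilRank Lη) :
    QuadraticBranchPlusEtaLowerInclusionAt V 5 ∧ QuadraticBranchPlusEtaMainConjectureAt V 5 := by
  subst hW
  have hb := IntModelTam.baseChange_rat_mk_int 1 0 0 (-13263) 613017
  haveI : ((⟨1, 0, 0, (-13263), 613017⟩ : WeierstrassCurve ℤ).baseChange ℚ).IsElliptic :=
    TamLocal.isElliptic_of_rowCheck rowCheck_v69150v1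
  haveI : ((⟨1, 0, 0, (-13263), 613017⟩ : WeierstrassCurve ℤ).baseChange ℚ).IsGloballyMinimal := by
    rw [hb]; exact isGloballyMinimal_v69150v1
  have hD : ((-1 : ℚ) ^ ((5 : ℕ) / 2) * ((5 : ℕ) : ℚ)) = 5 := by norm_num
  refine etaPair_of_rowCheck_of_tamagawaPair_of_heightIndexDvd h12 h13 h22 h41 hKO hPT (le_refl 5)
    rowCheck_v69150v1 [2, 3] (by decide) (by decide) (by decide) (by decide) (by decide) rfl
    (hrW := by rw [hb]; exact hrW) V C (by rw [hb, hD]; exact hCV) hgood hap hsurj (fun f hf => hcertV f hf) 1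
    (fun K₀ _ _ _ _ ηq hηK hη1 κ γ hκ hγ hγK hγc D => by
      rw [pow_one]; exact hht K₀ ηq hηK hη1 κ γ hκ hγ hγK hγc D) ?_
  intro N _ f hf ϖ hϖ Lη hL
  rw [hD]
  exact han hf ϖ hϖ Lη hL

end PlusEtaR1HeightRows

end Summit.BirchSwinnertonDyer.BirchSwinnertonDyer.Theorems

end
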